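import Summits.ABC.IUTFork.Repair.CandInternal2
import Summits.ABC.IUTFork.Repair.CandExplicit4
import Summits.ABC.IUTFork.Repair.CandMochizuki4
import Summits.ABC.IUTFork.Repair.CandMochizuki32
import Summits.ABC.IUTFork.Repair.CandExplicit1
import Summits.ABC.IUTFork.Repair.CandMochizuki6
import Summits.ABC.IUTFork.Repair.CandMochizuki6Tests
import Summits.ABC.IUTFork.Repair.EvalComparison
import Summits.ABC.IUTFork.Cor312PinnedFrameFlip
import Summits.ABC.IUTFork.Cor312PilotKummerCompatProtocolSatPlus
import HarnessLib

/-!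
# IUT REPAIR branch (rung LADDER-ABC:A2.RP) — the FRAME-FLIP COLUMN of the level-H/S rows (seat abc-iut-rp-cx, T-b/T-c engine)

Record-only, proof-only file (D-0012; NO definition, NO `Prop` fact). TAKES NO SIDE on [IUTchIII] Cor. 3.12 or on any author;
every candidate below is the author's HYPOTHESIS imported BY NAME (`Repair.CandInternal2.HQShellOrbit` RP-I06, `Repair.CandExplicit4.H`
RP-X04, `Repair.CandMochizuki4.H'` RP-M04b, `Repair.CandMochizuki32.H''` RP-M32c, `Repair.CandExplicit1.H_Englf` RP-X01b,
`Repair.CandMochizuki6.H''` RP-M36c, Team B's `VolumeTransport` / `QFrobComparison` RP-C01), never asserted; typed ≠ proved; instantiated ≠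
endorsed.

WHAT. Every level-H SUPPLIER row landed so far has the SAME log-shell profile `{d | 3 ≤ d}` (plan/repair/cx/XREAD-1/2.md §1). This file
evaluates them at abc-iut-w4-d103's FRAME-FLIP model `PinnedHonest.flipSetting p` (p427066; same lattice, pilots, glue fields and honest
regions/volumes as the pinned countermodel — only the hull FRAME is coarse, `hull B_4 = B_1`), with the holomorphic reading `orbitRegion p`
and the datum `qDatum p`. The column SPLITS the level-H rows into two kernel-distinct families:
* **FRAME-SENSITIVE (HOLD at the flip)** — inclusions into the holomorphic HULL: RP-M04b (`CandMochizuki6Tests.M04b_at_flipSetting`, rp-m2), RP-M32c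
  (`m32c_holds_at_flip`), RP-X01b (`x01b_holds_at_flip`), RP-M36c (packet q-volume ≤ hull volume, `CandMochizuki6Tests.M36c_at_flipSetting`, rp-m2); each is then
  SAT+ by abc-iut-w5-d068's engine P6 `RepairProtocol.satPlus_of_holds_at_flipSetting` («frame-flip witness», e.g. `m04b_satPlus_flip`).
* **FRAME-BLIND (FAIL at the flip)** — inclusions into / comparisons with the (Ind3)-saturated Θ-REGION or its volumes: RP-X04
  (`x04_fails_at_flip`: `B_1 ⊄ B_4` at label 2), RP-I06 (`i06_fails_at_flip`: the log-shell orbit of the Θ-data reads as `B_{j²}`),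
  RP-C01/VolumeTransport and RP-C01/QFrobComparison (`c01_fail_at_flip`: `−log p ≤ −4·log p` is false whatever the frame).
Both families have LS-profile `{d ≥ 3}`; the flip separates them (`flip_separates_levelH`). Reading (neutral): a frame-sensitive row is
satisfied by ANY inflation mechanism of the hull (coarse frame included); a frame-blind row needs the inflation INSIDE the Θ-pilot's own
(Ind3)-region or volumes. Which of the two the printed Step (xi) intends is the referees' T-d question, not decided here.
[claim: Mochizuki2012, status: disputed] [cite: ScholzeStix2018, §2.2 pp. 9–10]
-/

noncomputable section

namespace Summit.ABC.IUTFork.Repair.EvalFlipProfile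

open Thm311 Cor312 Cor312.Checks Cor312.IdentifiedNonVacuity Cor312Vol Literature.IUT.LogThetaLattice
open Cor312Vol.NaiveWitness Cor312Vol.PinnedWitness Cor312Vol.PinnedHonest Cor312Vol.RepairProtocol

variable (p : ℕ) [hp : Fact p.Prime]

/-! ## 1. Frame-SENSITIVE rows: HOLD at the flip (and are SAT+ by P6) -/

omit hp in
/-- Hence RP-M04b is SAT+ with a FRAME-FLIP witness (P6), at `p = 2`. [folklore] -/
theorem m04b_satPlus_flip :
    ∃ (T : ThetaIndex) (F : FullSituation T) (P : Cor312.Setting F.toLatticeSituation.toSituation)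
      (ρ : (∀ v : T.V, v ∈ T.Vbad → Set (F.L.StarPacket v)) → ∀ (j : T.Label) (vQ : T.VQ), Set (F.L.Packet j vQ))
      (qK : ∀ v : T.V, v ∈ T.Vbad → Set (F.L.StarPacket v)),
      F.Statement ∧ F.MultiradialCompat ∧ (F.col P.n).KummerB (F.D P.n) ∧ BridgeHyps P ∧ P.AbsLogQPos ∧
        PinnedRegions3 F.toLatticeSituation P ρ qK ∧
        (∀ Φ ∈ F.L.Ind1Family ∪ F.L.Ind2Family, ∀ j vQ (B : Set (F.L.Packet j vQ)),
          (F.D P.n).Adm j vQ B ↔ (F.D P.n).Adm j vQ (Φ j vQ '' B)) ∧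
        (F.D P.n).LogvolInvariant ∧
        (∀ (j : T.Label) (vQ : T.VQ), (F.D P.n).Adm j vQ (P.thetaRegion3 j vQ)) ∧
        (∀ (i : Fin T.lstar) (vQ : T.VQ),
          (F.D P.n).logvol _ vQ (P.thetaRegion3 (Setting.labelSucc i) vQ) =
            (((i : ℕ) + 1 : ℕ) : ℝ) ^ 2 * P.qLocal (Setting.labelSucc i) vQ) ∧
        (∀ (i i' : Fin T.lstar) (vQ : T.VQ), P.qLocal (Setting.labelSucc i) vQ = P.qLocal (Setting.labelSucc i') vQ) ∧
        (∀ (i : Fin T.lstar) (vQ : T.VQ), P.qLocal (Setting.labelSucc i) vQ < 0) ∧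
        CandMochizuki4.H' F.toLatticeSituation P ρ qK ∧
        PilotKummerCompatHull F.toLatticeSituation P ρ qK ∧ Thm311ToCor312.Licence P ∧ P.Statement ∧
        ¬ PilotKummerIndRelated F.toLatticeSituation P ρ qK :=
  satPlus_of_holds_at_flipSetting (H := fun S P ρ qK => CandMochizuki4.H' S P ρ qK) 2 (CandMochizuki6Tests.M04b_at_flipSetting 2)

/-- RP-M32c (`CandMochizuki32.H''`, hull-level Θ-intertwining) HOLDS at the frame flip: under the q-pin it is the hull clause
`PilotKummerCompatHull`, which holds there (abc-iut-w5-d068 `flip_pilotKummerCompatHull`). [folklore] -/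
theorem m32c_holds_at_flip :
    CandMochizuki32.H'' (naiveFull p).toLatticeSituation (flipSetting p) (orbitRegion p) (qDatum p) := by
  rw [CandMochizuki32.H''_iff_subset_hull]
  intro j vQ
  rw [(flip_pinnedRegions3 p).1.2 j vQ]
  exact flip_pilotKummerCompatHull p j vQ

/-- RP-X01b (`CandExplicit1.H_Englf`, (FxGl) ⟹ (Englf) at hull level) HOLDS at the frame flip (it is `PilotKummerCompatHull` given the
link pin, `CandExplicit1.H_Englf_iff`). [folklore] -/
theorem x01b_holds_at_flip :
    CandExplicit1.H_Englf (naiveFull p).toLatticeSituation (flipSetting p) (orbitRegion p) (qDatum p) :=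
  (CandExplicit1.H_Englf_iff _ _ _ _ (flip_pinnedRegions3 p).2).2 (flip_pilotKummerCompatHull p)

/-! ## 2. Frame-BLIND rows: FAIL at the flip -/

/-- RP-X04 (`CandExplicit4.H`: q-region ⊆ the (Ind3)-saturated Θ-region `thetaRegion3`) FAILS at the frame flip: the regions are
those of the pinned countermodel, `B_1 ⊄ B_4` at label `2`. [folklore] -/
theorem x04_fails_at_flip : ¬ CandExplicit4.H (naiveFull p).toLatticeSituation (flipSetting p) := by
  intro h
  have h2 := h (Setting.labelSucc ⟨1, by decide⟩) ()
  have hj : jsq (Setting.labelSucc (T := Checks.toyIndex) ⟨1, by decide⟩) = 4 := by decide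
  rw [flip_thetaRegion3, hj, show (flipSetting p).qRegion = (pinnedSetting p).qRegion from (flip_fields_eq p).2.1,
    pinnedSetting_qRegion_of_ne_zero p (Setting.labelSucc_ne_zero _), pBall_subset_iff] at h2
  omega

/-- RP-I06 (`CandInternal2.HQShellOrbit`: the q-datum's region lies in the log-shell orbit of the Θ-data) FAILS at the frame flip with
the holomorphic reading: every `ρ(Ψ_m·𝓘)` reads as `B_{j²}` (author's `orbitRegion_shellSat_Psi`; the model's typed log-shell is `𝒪`),
and `B_1 ⊄ B_4` at label `2`. [folklore] -/
theorem i06_fails_at_flip :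
    ¬ CandInternal2.HQShellOrbit (naiveFull p).toLatticeSituation (flipSetting p) (orbitRegion p) (qDatum p) := by
  intro h
  have hj : jsq (Setting.labelSucc (T := Checks.toyIndex) ⟨1, by decide⟩) = 4 := by decide
  have hΨ : ∀ m : ℤ, ((naiveFull p).toLatticeSituation.col (flipSetting p).n).frobΨ m = fun v _ => Psi p v :=
    fun m => naiveFull_frobΨ p _ m
  have h2 : orbitRegion p (qDatum p) (Setting.labelSucc ⟨1, by decide⟩) () ⊆
      ⋃ m : ℤ, orbitRegion p (CandInternal2.shellSat (naiveFull p).toLatticeSituation (flipSetting p).n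
        (((naiveFull p).toLatticeSituation.col (flipSetting p).n).frobΨ m)) (Setting.labelSucc ⟨1, by decide⟩) () := h _ _
  have hU : (⋃ m : ℤ, orbitRegion p (CandInternal2.shellSat (naiveFull p).toLatticeSituation (flipSetting p).n
        (((naiveFull p).toLatticeSituation.col (flipSetting p).n).frobΨ m)) (Setting.labelSucc ⟨1, by decide⟩) ()) =
      pBall p (Setting.labelSucc ⟨1, by decide⟩) () 4 := by
    rw [← hj]
    refine (Set.iUnion_congr fun m => ?_).trans (Set.iUnion_const _)
    rw [hΨ m]
    exact CandInternal2.orbitRegion_shellSat_Psi p _ _ _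
  rw [hU, orbitRegion_qDatum p (Setting.labelSucc_ne_zero _), pBall_subset_iff] at h2
  omega

/-- RP-C01: Team B's `VolumeTransport` and `QFrobComparison` FAIL at the frame flip (the flip keeps the pinned countermodel's regions
and volumes; `−log p ≤ −4·log p` is false). [folklore] -/
theorem c01_fail_at_flip :
    ¬ VolumeTransport (S := (naiveFull p).toLatticeSituation.toSituation) (flipSetting p) ∧
      ¬ QFrobComparison (S' := (naiveFull p).toLatticeSituation) (flipSetting p) :=
  ⟨pinnedSetting_not_volumeTransport p, EvalComparison.pinnedSetting_not_qFrobComparison p⟩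

/-! ## 3. The split, packaged -/

/-- **The frame flip SEPARATES the level-H rows** (every prime `p`): at ONE model passing the honesty checklist (typed Thm. 3.11,
bridge hypotheses, `|log(q)| > 0`, three pins, honest `j²`-volumes) the hull-inclusion rows HOLD and the Θ-region/volume rows FAIL,
although all of them have the log-shell profile `{d ≥ 3}`. [folklore] -/
theorem flip_separates_levelH :
    PinnedRegions3 (naiveFull p).toLatticeSituation (flipSetting p) (orbitRegion p) (qDatum p) ∧ BridgeHyps (flipSetting p) ∧
      (flipSetting p).AbsLogQPos ∧ Cor312.Setting.Statement (flipSetting p) ∧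
      (CandMochizuki4.H' (naiveFull p).toLatticeSituation (flipSetting p) (orbitRegion p) (qDatum p) ∧
        CandMochizuki32.H'' (naiveFull p).toLatticeSituation (flipSetting p) (orbitRegion p) (qDatum p) ∧
        CandExplicit1.H_Englf (naiveFull p).toLatticeSituation (flipSetting p) (orbitRegion p) (qDatum p) ∧
        CandMochizuki6.H'' (naiveFull p).toLatticeSituation (flipSetting p)) ∧
      (¬ CandExplicit4.H (naiveFull p).toLatticeSituation (flipSetting p) ∧
        ¬ CandInternal2.HQShellOrbit (naiveFull p).toLatticeSituation (flipSetting p) (orbitRegion p) (qDatum p) ∧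
        ¬ VolumeTransport (S := (naiveFull p).toLatticeSituation.toSituation) (flipSetting p) ∧
        ¬ QFrobComparison (S' := (naiveFull p).toLatticeSituation) (flipSetting p)) :=
  ⟨flip_pinnedRegions3 p, flip_bridgeHyps p, flip_absLogQPos p, flip_statement p,
    ⟨CandMochizuki6Tests.M04b_at_flipSetting p, m32c_holds_at_flip p, x01b_holds_at_flip p, CandMochizuki6Tests.M36c_at_flipSetting p⟩,
    ⟨x04_fails_at_flip p, i06_fails_at_flip p, (c01_fail_at_flip p).1, (c01_fail_at_flip p).2⟩⟩

end Summit.ABC.IUTFork.Repair.EvalFlipProfile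

end
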